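import Summits.ResolutionOfSingularities.ResolutionOfSingularities.Theorems.EquisingularLiftEquisingularLiftNatAffineOneStepOrigin
import Summits.ResolutionOfSingularities.ResolutionOfSingularities.Theorems.EquisingularLiftEquisingularLiftNatTwoStepVertexChart
import HarnessLib

/-!
# [OURS] THE AFFINE TWO-STEP CLASSIFICATION (scheme side, brick B3-core of the level-1 bridge): for `Spec K[y]/(Φ + Ψ)` with DISJUNCTIVE second-order
# data, every point of every blow-up along the origin lying over the origin is REGULAR OR THE IMAGE OF A CHART ORIGIN under the chart's open immersion;
# these exceptional candidates are at most `N + 1`, hence FINITELY many, and CLOSED points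
# (cruxes `Theses.EquisingularLift.EquisingularLiftNat` / `…NatThree` / `EquisingularLift`, stmt-ResolutionOfSingularities-20038 / -20148 / -15660)

[OURS · leafhand-res-equisingularlift-11 g0, 2026-08-31; cell `pub/decomp-res`] AI-produced, weaker than expert review; NOT a statement of any manuscript;
nothing here proves resolution of singularities in positive characteristic.  DEF-FREE helper; no `sorry`; standard axioms; ZERO named hypotheses.

Inputs: ✓ `IsBlowup.exists_chart_of_span_range_eq` (Stacks 0804: a chart `Spec (A/(f))[Ī/ȳ_a] → Z` through every point), ✓ `OneStep.exists_chartEquiv_regular_or_eq_origin`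
(p833140: the chart ring is `K[T]/(G_a)`; over the exceptional divisor its primes are regular-localised or the chart origin), ✓ `IsBlowup.hom_ext` (two charts of
the same index agree: effective Cartier pull-back along the flat open immersion, ✓ `IsEffectiveCartier.comap_of_flat`), Mathlib's Jacobson spaces (a point closed in
an open of a scheme locally of finite type over a field is closed).

* ★★★ `OneStep.exists_chart_origin_of_not_isRegularLocalRing` — `f = Φ + Ψ`, chart data `G_a` with the total-transform identities and the disjunctive Jacobian
  datum; `ρ : Z → Spec (K[y]/(f))` a blow-up along the origin (`ofIdealTop`), `z` over the origin with `𝒪_{Z,z}` NOT regular ⟹ for some chart `a`: an open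
  immersion `φ : Spec (A/(f))[Ī/ȳ_a] → Z` over `Spec (A/(f))` and the point `w₀` of the chart ring with ideal `χ_a((T̄))` (the chart origin) with `φ w₀ = z`;
* ★★ `OneStep.finite_setOf_not_isRegularLocalRing` — the set of non-regular points of `Z` over the origin is FINITE (the chart index is injective on it);
* ★★ `OneStep.isClosed_singleton_of_not_isRegularLocalRing` — each such point is CLOSED in `Z`.

Remaining for level `1` at the origin (next hand, S/M): one-step AT these points — ✓ `OneStep.oneStepAt_origin` for `G_a = Φ'_a + Ψ'_a` transported along
`Spec χ_a` (✓ `PointChain.oneStepAt_of_iso`) and the open immersion `φ` (✓ `PointChain.stepAt_of_open` / `oneStepAt_iff_of_isIso_morphismRestrict`) — and the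
packaging into the `hDsucc` clause of ✓ `towerLevel_succ_of_model`; then ✓ `tower_loc` along the vertex chart of `V₊(F)`.  Honest label: closes no registered stub.

References: [StacksProject, Tags 0804, 02OS, 01TB]; [GortzWedhorn2020, Prop. 13.91, 13.96]; through the cited tree files.
-/

set_option linter.dupNamespace false -- mandated namespace `Summit.<Summit>.<Problem>` of this single-conjunct summit

noncomputable section

open CategoryTheory CategoryTheory.Limits AlgebraicGeometry TopologicalSpace Topology
open MvPolynomial
open Literature.AlgebraicGeometry.Resolution
open AlgebraicGeometry.Scheme.IdealSheafData

namespace Summit.ResolutionOfSingularities.ResolutionOfSingularities.Cruxes.EquisingularLiftNat.Sections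

namespace OneStep

variable (K : Type) [Field K] {N : ℕ} (Φ Ψ : MvPolynomial (Fin (N + 1)) K) {μ : ℕ}

set_option maxHeartbeats 800000 in -- the chart algebra `blowupAlgebra` is a subalgebra of a localisation: slow instance unification (as in …NatOneStepVertexChart)
/-- ★★★ **NON-REGULAR POINTS OVER THE ORIGIN ARE CHART ORIGINS.**  `f = Φ + Ψ` (`Φ ≠ 0` a form of degree `μ`, `Ψ ∈ (y)^{μ+1}`); for every chart `a` a
strict transform `G_a` with `f(T_a, T_aT_j) = T_a^μ·G_a` and the DISJUNCTIVE datum «at every prime `P ∋ T_a, G_a` some `∂_jG_a ∉ P` or `P ⊇ (T)`».  Let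
`ρ : Z → Spec (K[y]/(f))` be a blow-up along the origin and `z` a point over the origin whose local ring is NOT regular.  Then for some `a` there are the
chart isomorphism `χ : K[T]/(G_a) ≃ (A/(f))[Ī/ȳ_a]` of ✓ `exists_chartEquiv_regular_or_eq_origin`, an open immersion `φ` of the chart into `Z` over the base,
and the point `w₀` of the chart with ideal `χ((T̄))`, with `φ w₀ = z`. [OURS] [cite: StacksProject, Tag 0804] [cite: GortzWedhorn2020, Prop. 13.96] -/
theorem exists_chart_origin_of_not_isRegularLocalRing (hΦ : Φ.IsHomogeneous μ) (hΦ0 : Φ ≠ 0)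
    (hΨ : Ψ ∈ Ideal.span (Set.range (X : Fin (N + 1) → MvPolynomial (Fin (N + 1)) K)) ^ (μ + 1))
    (G : Fin (N + 1) → MvPolynomial (Fin (N + 1)) K)
    (hG : ∀ a, aeval (fun j => X a * Function.update (X : Fin (N + 1) → MvPolynomial (Fin (N + 1)) K) a 1 j) (Φ + Ψ) = X a ^ μ * G a)
    (hjac : ∀ a, ∀ P : Ideal (MvPolynomial (Fin (N + 1)) K), P.IsPrime → (X a : MvPolynomial (Fin (N + 1)) K) ∈ P → G a ∈ P →
      (∃ j, pderiv j (G a) ∉ P) ∨ ∀ i, (X i : MvPolynomial (Fin (N + 1)) K) ∈ P)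
    {Z : Scheme.{0}} {ρ : Z ⟶ Spec (CommRingCat.of (MvPolynomial (Fin (N + 1)) K ⧸ Ideal.span {Φ + Ψ}))}
    (hρ : IsBlowup ρ (ofIdealTop (Ideal.map (Scheme.ΓSpecIso (CommRingCat.of (MvPolynomial (Fin (N + 1)) K ⧸ Ideal.span {Φ + Ψ}))).inv.hom
      (Ideal.map (Ideal.Quotient.mk (Ideal.span {Φ + Ψ})) (Ideal.span (Set.range (X : Fin (N + 1) → MvPolynomial (Fin (N + 1)) K)))))))
    (z : Z)
    (hz : ρ z ∈ ((ofIdealTop (Ideal.map (Scheme.ΓSpecIso (CommRingCat.of (MvPolynomial (Fin (N + 1)) K ⧸ Ideal.span {Φ + Ψ}))).inv.hom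
      (Ideal.map (Ideal.Quotient.mk (Ideal.span {Φ + Ψ})) (Ideal.span (Set.range (X : Fin (N + 1) → MvPolynomial (Fin (N + 1)) K)))))).support :
        Set (Spec (CommRingCat.of (MvPolynomial (Fin (N + 1)) K ⧸ Ideal.span {Φ + Ψ})))))
    (hzreg : ¬ IsRegularLocalRing (Z.presheaf.stalk z)) :
    ∃ (a : Fin (N + 1))
      (χ : (MvPolynomial (Fin (N + 1)) K ⧸ Ideal.span {G a}) ≃+*
        blowupAlgebra ((Ideal.span (Set.range (X : Fin (N + 1) → MvPolynomial (Fin (N + 1)) K))).map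
          (Ideal.Quotient.mk (Ideal.span {Φ + Ψ}))) (Ideal.Quotient.mk (Ideal.span {Φ + Ψ}) (X a)))
      (φ : Spec (CommRingCat.of (blowupAlgebra ((Ideal.span (Set.range (X : Fin (N + 1) → MvPolynomial (Fin (N + 1)) K))).map
          (Ideal.Quotient.mk (Ideal.span {Φ + Ψ}))) (Ideal.Quotient.mk (Ideal.span {Φ + Ψ}) (X a)))) ⟶ Z)
      (_ : IsOpenImmersion φ)
      (w₀ : Spec (CommRingCat.of (blowupAlgebra ((Ideal.span (Set.range (X : Fin (N + 1) → MvPolynomial (Fin (N + 1)) K))).map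
          (Ideal.Quotient.mk (Ideal.span {Φ + Ψ}))) (Ideal.Quotient.mk (Ideal.span {Φ + Ψ}) (X a))))),
      χ (Ideal.Quotient.mk (Ideal.span {G a}) (X a)) =
        algebraMap (MvPolynomial (Fin (N + 1)) K ⧸ Ideal.span {Φ + Ψ}) _ (Ideal.Quotient.mk (Ideal.span {Φ + Ψ}) (X a)) ∧
      φ ≫ ρ = Spec.map (CommRingCat.ofHom (algebraMap (MvPolynomial (Fin (N + 1)) K ⧸ Ideal.span {Φ + Ψ})
        (blowupAlgebra ((Ideal.span (Set.range (X : Fin (N + 1) → MvPolynomial (Fin (N + 1)) K))).map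
          (Ideal.Quotient.mk (Ideal.span {Φ + Ψ}))) (Ideal.Quotient.mk (Ideal.span {Φ + Ψ}) (X a))))) ∧
      w₀.asIdeal = Ideal.map χ.toRingHom (Ideal.map (Ideal.Quotient.mk (Ideal.span {G a}))
        (Ideal.span (Set.range (X : Fin (N + 1) → MvPolynomial (Fin (N + 1)) K)))) ∧
      φ w₀ = z := by
  classical
  let g : Fin (N + 1) → (MvPolynomial (Fin (N + 1)) K ⧸ Ideal.span {Φ + Ψ}) := fun i => Ideal.Quotient.mk (Ideal.span {Φ + Ψ}) (X i)
  have hg : Ideal.span (Set.range g) =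
      Ideal.map (Ideal.Quotient.mk (Ideal.span {Φ + Ψ})) (Ideal.span (Set.range (X : Fin (N + 1) → MvPolynomial (Fin (N + 1)) K))) := by
    rw [Ideal.map_span, ← Set.range_comp]
    rfl
  obtain ⟨a, φ, hφ, hzφ, hφρ⟩ := IsBlowup.exists_chart_of_span_range_eq
    (A := CommRingCat.of (MvPolynomial (Fin (N + 1)) K ⧸ Ideal.span {Φ + Ψ})) hρ g hg z
  obtain ⟨w, hw⟩ := hzφ
  have hbw : algebraMap (MvPolynomial (Fin (N + 1)) K ⧸ Ideal.span {Φ + Ψ})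
      (blowupAlgebra (Ideal.map (Ideal.Quotient.mk (Ideal.span {Φ + Ψ}))
        (Ideal.span (Set.range (X : Fin (N + 1) → MvPolynomial (Fin (N + 1)) K)))) (g a)) (g a) ∈ w.asIdeal := by
    have hyw : ρ z = Spec.map (CommRingCat.ofHom (algebraMap (MvPolynomial (Fin (N + 1)) K ⧸ Ideal.span {Φ + Ψ})
        (blowupAlgebra (Ideal.map (Ideal.Quotient.mk (Ideal.span {Φ + Ψ}))
          (Ideal.span (Set.range (X : Fin (N + 1) → MvPolynomial (Fin (N + 1)) K)))) (g a)))) w := by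
      rw [← hw]
      exact congrArg (fun f => f w) hφρ
    have hy' := hz
    rw [hyw, Scheme.IdealSheafData.coe_support_ofIdealTop, Spec_zeroLocus, Spec.map_apply] at hy'
    have hmem : g a ∈ (Scheme.ΓSpecIso (CommRingCat.of (MvPolynomial (Fin (N + 1)) K ⧸ Ideal.span {Φ + Ψ}))).inv ⁻¹'
        ((Ideal.map (Scheme.ΓSpecIso (CommRingCat.of (MvPolynomial (Fin (N + 1)) K ⧸ Ideal.span {Φ + Ψ}))).inv.hom
          (Ideal.map (Ideal.Quotient.mk (Ideal.span {Φ + Ψ})) (Ideal.span (Set.range (X : Fin (N + 1) → MvPolynomial (Fin (N + 1)) K))))) : Set _) :=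
      Ideal.mem_map_of_mem _ (hg ▸ Ideal.subset_span ⟨a, rfl⟩)
    have h := (PrimeSpectrum.mem_zeroLocus _ _).mp hy' hmem
    rw [PrimeSpectrum.comap_asIdeal] at h
    exact h
  -- the chart ring is `K[T]/(G_a)`; `w` is regular-localised (excluded) or the chart origin
  obtain ⟨χ, hχa, hχ⟩ := exists_chartEquiv_regular_or_eq_origin K Φ Ψ hΦ hΦ0 hΨ a (G a) (hG a)
  haveI : w.asIdeal.IsPrime := w.isPrime
  rcases hχ (hjac a) w.asIdeal hbw with hreg | horig
  · exfalso
    rw [← hw] at hzreg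
    haveI := hreg
    exact not_isRegularLocalRing_localization_of_stalk φ w hzreg inferInstance
  · exact ⟨a, χ, φ, hφ, w, hχa, hφρ, horig, hw⟩

/-- **Two charts of the same index through non-regular points over the origin give the same point**: the charts coincide (`IsBlowup.hom_ext`, the centre
pulling back to an effective Cartier divisor along the flat open immersion), and in the chart ring both points are THE origin (✓ `exists_chartEquiv_regular_or_eq_origin`).
[OURS] [cite: StacksProject, Tag 0804] -/
theorem eq_of_sameChart_of_not_isRegularLocalRing (hΦ : Φ.IsHomogeneous μ) (hΦ0 : Φ ≠ 0)
    (hΨ : Ψ ∈ Ideal.span (Set.range (X : Fin (N + 1) → MvPolynomial (Fin (N + 1)) K)) ^ (μ + 1))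
    (G : Fin (N + 1) → MvPolynomial (Fin (N + 1)) K)
    (hG : ∀ a, aeval (fun j => X a * Function.update (X : Fin (N + 1) → MvPolynomial (Fin (N + 1)) K) a 1 j) (Φ + Ψ) = X a ^ μ * G a)
    (hjac : ∀ a, ∀ P : Ideal (MvPolynomial (Fin (N + 1)) K), P.IsPrime → (X a : MvPolynomial (Fin (N + 1)) K) ∈ P → G a ∈ P →
      (∃ j, pderiv j (G a) ∉ P) ∨ ∀ i, (X i : MvPolynomial (Fin (N + 1)) K) ∈ P)
    {Z : Scheme.{0}} {ρ : Z ⟶ Spec (CommRingCat.of (MvPolynomial (Fin (N + 1)) K ⧸ Ideal.span {Φ + Ψ}))}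
    (hρ : IsBlowup ρ (ofIdealTop (Ideal.map (Scheme.ΓSpecIso (CommRingCat.of (MvPolynomial (Fin (N + 1)) K ⧸ Ideal.span {Φ + Ψ}))).inv.hom (Ideal.map (Ideal.Quotient.mk (Ideal.span {Φ + Ψ})) (Ideal.span (Set.range (X : Fin (N + 1) → MvPolynomial (Fin (N + 1)) K)))))))
    (a₁ a₂ : Fin (N + 1)) (ha : a₁ = a₂)
    (φ₁ : Spec (CommRingCat.of (blowupAlgebra (Ideal.map (Ideal.Quotient.mk (Ideal.span {Φ + Ψ})) (Ideal.span (Set.range (X : Fin (N + 1) → MvPolynomial (Fin (N + 1)) K)))) (Ideal.Quotient.mk (Ideal.span {Φ + Ψ}) (X a₁)))) ⟶ Z) [IsOpenImmersion φ₁]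
    (φ₂ : Spec (CommRingCat.of (blowupAlgebra (Ideal.map (Ideal.Quotient.mk (Ideal.span {Φ + Ψ})) (Ideal.span (Set.range (X : Fin (N + 1) → MvPolynomial (Fin (N + 1)) K)))) (Ideal.Quotient.mk (Ideal.span {Φ + Ψ}) (X a₂)))) ⟶ Z) [IsOpenImmersion φ₂]
    (hφ₁ : φ₁ ≫ ρ = Spec.map (CommRingCat.ofHom (algebraMap (MvPolynomial (Fin (N + 1)) K ⧸ Ideal.span {Φ + Ψ}) (blowupAlgebra (Ideal.map (Ideal.Quotient.mk (Ideal.span {Φ + Ψ})) (Ideal.span (Set.range (X : Fin (N + 1) → MvPolynomial (Fin (N + 1)) K)))) (Ideal.Quotient.mk (Ideal.span {Φ + Ψ}) (X a₁))))))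
    (hφ₂ : φ₂ ≫ ρ = Spec.map (CommRingCat.ofHom (algebraMap (MvPolynomial (Fin (N + 1)) K ⧸ Ideal.span {Φ + Ψ}) (blowupAlgebra (Ideal.map (Ideal.Quotient.mk (Ideal.span {Φ + Ψ})) (Ideal.span (Set.range (X : Fin (N + 1) → MvPolynomial (Fin (N + 1)) K)))) (Ideal.Quotient.mk (Ideal.span {Φ + Ψ}) (X a₂))))))
    (w₁ : Spec (CommRingCat.of (blowupAlgebra (Ideal.map (Ideal.Quotient.mk (Ideal.span {Φ + Ψ})) (Ideal.span (Set.range (X : Fin (N + 1) → MvPolynomial (Fin (N + 1)) K)))) (Ideal.Quotient.mk (Ideal.span {Φ + Ψ}) (X a₁))))) (w₂ : Spec (CommRingCat.of (blowupAlgebra (Ideal.map (Ideal.Quotient.mk (Ideal.span {Φ + Ψ})) (Ideal.span (Set.range (X : Fin (N + 1) → MvPolynomial (Fin (N + 1)) K)))) (Ideal.Quotient.mk (Ideal.span {Φ + Ψ}) (X a₂)))))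
    (hz₁ : ρ (φ₁ w₁) ∈ ((ofIdealTop (Ideal.map (Scheme.ΓSpecIso (CommRingCat.of (MvPolynomial (Fin (N + 1)) K ⧸ Ideal.span {Φ + Ψ}))).inv.hom (Ideal.map (Ideal.Quotient.mk (Ideal.span {Φ + Ψ})) (Ideal.span (Set.range (X : Fin (N + 1) → MvPolynomial (Fin (N + 1)) K)))))).support : Set (Spec (CommRingCat.of (MvPolynomial (Fin (N + 1)) K ⧸ Ideal.span {Φ + Ψ})))))
    (hz₂ : ρ (φ₂ w₂) ∈ ((ofIdealTop (Ideal.map (Scheme.ΓSpecIso (CommRingCat.of (MvPolynomial (Fin (N + 1)) K ⧸ Ideal.span {Φ + Ψ}))).inv.hom (Ideal.map (Ideal.Quotient.mk (Ideal.span {Φ + Ψ})) (Ideal.span (Set.range (X : Fin (N + 1) → MvPolynomial (Fin (N + 1)) K)))))).support : Set (Spec (CommRingCat.of (MvPolynomial (Fin (N + 1)) K ⧸ Ideal.span {Φ + Ψ})))))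
    (hr₁ : ¬ IsRegularLocalRing (Z.presheaf.stalk (φ₁ w₁))) (hr₂ : ¬ IsRegularLocalRing (Z.presheaf.stalk (φ₂ w₂))) :
    φ₁ w₁ = φ₂ w₂ := by
  classical
  subst ha
  -- the charts agree
  have hcart : IsEffectiveCartier ((ofIdealTop (Ideal.map (Scheme.ΓSpecIso (CommRingCat.of (MvPolynomial (Fin (N + 1)) K ⧸ Ideal.span {Φ + Ψ}))).inv.hom (Ideal.map (Ideal.Quotient.mk (Ideal.span {Φ + Ψ})) (Ideal.span (Set.range (X : Fin (N + 1) → MvPolynomial (Fin (N + 1)) K)))))).comap (φ₁ ≫ ρ)) := by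
    rw [Scheme.IdealSheafData.comap_comp]
    exact hρ.isEffectiveCartier.comap_of_flat _
  have hφ : φ₁ = φ₂ := hρ.hom_ext hcart (hφ₁.trans hφ₂.symm)
  subst hφ
  -- in the chart ring both points contain the exceptional equation and are not regular-localised: both are the origin
  have hgen : ∀ (w : Spec (CommRingCat.of (blowupAlgebra (Ideal.map (Ideal.Quotient.mk (Ideal.span {Φ + Ψ})) (Ideal.span (Set.range (X : Fin (N + 1) → MvPolynomial (Fin (N + 1)) K)))) (Ideal.Quotient.mk (Ideal.span {Φ + Ψ}) (X a₁))))), ρ (φ₁ w) ∈ ((ofIdealTop (Ideal.map (Scheme.ΓSpecIso (CommRingCat.of (MvPolynomial (Fin (N + 1)) K ⧸ Ideal.span {Φ + Ψ}))).inv.hom (Ideal.map (Ideal.Quotient.mk (Ideal.span {Φ + Ψ})) (Ideal.span (Set.range (X : Fin (N + 1) → MvPolynomial (Fin (N + 1)) K)))))).support : Set (Spec (CommRingCat.of (MvPolynomial (Fin (N + 1)) K ⧸ Ideal.span {Φ + Ψ})))) →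
      algebraMap (MvPolynomial (Fin (N + 1)) K ⧸ Ideal.span {Φ + Ψ}) (blowupAlgebra (Ideal.map (Ideal.Quotient.mk (Ideal.span {Φ + Ψ})) (Ideal.span (Set.range (X : Fin (N + 1) → MvPolynomial (Fin (N + 1)) K)))) (Ideal.Quotient.mk (Ideal.span {Φ + Ψ}) (X a₁))) (Ideal.Quotient.mk (Ideal.span {Φ + Ψ}) (X a₁)) ∈ w.asIdeal := by
    intro w hw
    have hyw : ρ (φ₁ w) = Spec.map (CommRingCat.ofHom (algebraMap (MvPolynomial (Fin (N + 1)) K ⧸ Ideal.span {Φ + Ψ}) (blowupAlgebra (Ideal.map (Ideal.Quotient.mk (Ideal.span {Φ + Ψ})) (Ideal.span (Set.range (X : Fin (N + 1) → MvPolynomial (Fin (N + 1)) K)))) (Ideal.Quotient.mk (Ideal.span {Φ + Ψ}) (X a₁))))) w :=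
      congrArg (fun f => f w) hφ₁
    rw [hyw, Scheme.IdealSheafData.coe_support_ofIdealTop, Spec_zeroLocus, Spec.map_apply] at hw
    have hmem : Ideal.Quotient.mk (Ideal.span {Φ + Ψ}) (X a₁) ∈ (Scheme.ΓSpecIso (CommRingCat.of (MvPolynomial (Fin (N + 1)) K ⧸ Ideal.span {Φ + Ψ}))).inv ⁻¹' ((Ideal.map (Scheme.ΓSpecIso (CommRingCat.of (MvPolynomial (Fin (N + 1)) K ⧸ Ideal.span {Φ + Ψ}))).inv.hom (Ideal.map (Ideal.Quotient.mk (Ideal.span {Φ + Ψ})) (Ideal.span (Set.range (X : Fin (N + 1) → MvPolynomial (Fin (N + 1)) K))))) : Set _) :=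
      Ideal.mem_map_of_mem _ (Ideal.mem_map_of_mem _ (Ideal.subset_span ⟨a₁, rfl⟩))
    have h := (PrimeSpectrum.mem_zeroLocus _ _).mp hw hmem
    rw [PrimeSpectrum.comap_asIdeal] at h
    exact h
  obtain ⟨χ, hχa, hχ⟩ := exists_chartEquiv_regular_or_eq_origin K Φ Ψ hΦ hΦ0 hΨ a₁ (G a₁) (hG a₁)
  haveI : w₁.asIdeal.IsPrime := w₁.isPrime
  haveI : w₂.asIdeal.IsPrime := w₂.isPrime
  have e1 := (hχ (hjac a₁) w₁.asIdeal (hgen w₁ hz₁)).resolve_left (not_isRegularLocalRing_localization_of_stalk φ₁ w₁ hr₁)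
  have e2 := (hχ (hjac a₁) w₂.asIdeal (hgen w₂ hz₂)).resolve_left (not_isRegularLocalRing_localization_of_stalk φ₁ w₂ hr₂)
  rw [PrimeSpectrum.ext (e1.trans e2.symm)]

/-- ★★ **THE NON-REGULAR POINTS OVER THE ORIGIN ARE FINITELY MANY** (at most one per chart index). [OURS] [cite: StacksProject, Tag 0804] -/
theorem finite_setOf_not_isRegularLocalRing (hΦ : Φ.IsHomogeneous μ) (hΦ0 : Φ ≠ 0)
    (hΨ : Ψ ∈ Ideal.span (Set.range (X : Fin (N + 1) → MvPolynomial (Fin (N + 1)) K)) ^ (μ + 1))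
    (G : Fin (N + 1) → MvPolynomial (Fin (N + 1)) K)
    (hG : ∀ a, aeval (fun j => X a * Function.update (X : Fin (N + 1) → MvPolynomial (Fin (N + 1)) K) a 1 j) (Φ + Ψ) = X a ^ μ * G a)
    (hjac : ∀ a, ∀ P : Ideal (MvPolynomial (Fin (N + 1)) K), P.IsPrime → (X a : MvPolynomial (Fin (N + 1)) K) ∈ P → G a ∈ P →
      (∃ j, pderiv j (G a) ∉ P) ∨ ∀ i, (X i : MvPolynomial (Fin (N + 1)) K) ∈ P)
    {Z : Scheme.{0}} {ρ : Z ⟶ Spec (CommRingCat.of (MvPolynomial (Fin (N + 1)) K ⧸ Ideal.span {Φ + Ψ}))}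
    (hρ : IsBlowup ρ (ofIdealTop (Ideal.map (Scheme.ΓSpecIso (CommRingCat.of (MvPolynomial (Fin (N + 1)) K ⧸ Ideal.span {Φ + Ψ}))).inv.hom (Ideal.map (Ideal.Quotient.mk (Ideal.span {Φ + Ψ})) (Ideal.span (Set.range (X : Fin (N + 1) → MvPolynomial (Fin (N + 1)) K))))))) :
    Set.Finite {z : Z | ρ z ∈ ((ofIdealTop (Ideal.map (Scheme.ΓSpecIso (CommRingCat.of (MvPolynomial (Fin (N + 1)) K ⧸ Ideal.span {Φ + Ψ}))).inv.hom (Ideal.map (Ideal.Quotient.mk (Ideal.span {Φ + Ψ})) (Ideal.span (Set.range (X : Fin (N + 1) → MvPolynomial (Fin (N + 1)) K)))))).support : Set (Spec (CommRingCat.of (MvPolynomial (Fin (N + 1)) K ⧸ Ideal.span {Φ + Ψ})))) ∧ ¬ IsRegularLocalRing (Z.presheaf.stalk z)} := by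
  classical
  have hch := fun (z : Z) (h : ρ z ∈ ((ofIdealTop (Ideal.map (Scheme.ΓSpecIso (CommRingCat.of (MvPolynomial (Fin (N + 1)) K ⧸ Ideal.span {Φ + Ψ}))).inv.hom (Ideal.map (Ideal.Quotient.mk (Ideal.span {Φ + Ψ})) (Ideal.span (Set.range (X : Fin (N + 1) → MvPolynomial (Fin (N + 1)) K)))))).support : Set (Spec (CommRingCat.of (MvPolynomial (Fin (N + 1)) K ⧸ Ideal.span {Φ + Ψ})))) ∧ ¬ IsRegularLocalRing (Z.presheaf.stalk z)) =>
    exists_chart_origin_of_not_isRegularLocalRing K Φ Ψ hΦ hΦ0 hΨ G hG hjac hρ z h.1 h.2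
  choose a χ φ hφ w₀ hχa hφρ hw₀ hφw using hch
  refine Set.Finite.of_finite_image (f := fun z => if h : ρ z ∈ ((ofIdealTop (Ideal.map (Scheme.ΓSpecIso (CommRingCat.of (MvPolynomial (Fin (N + 1)) K ⧸ Ideal.span {Φ + Ψ}))).inv.hom (Ideal.map (Ideal.Quotient.mk (Ideal.span {Φ + Ψ})) (Ideal.span (Set.range (X : Fin (N + 1) → MvPolynomial (Fin (N + 1)) K)))))).support : Set (Spec (CommRingCat.of (MvPolynomial (Fin (N + 1)) K ⧸ Ideal.span {Φ + Ψ})))) ∧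
      ¬ IsRegularLocalRing (Z.presheaf.stalk z) then a z h else 0) (Set.toFinite _) ?_
  intro z₁ hz₁ z₂ hz₂ heq
  simp only [Set.mem_setOf_eq] at hz₁ hz₂
  simp only [dif_pos hz₁, dif_pos hz₂] at heq
  haveI := hφ z₁ hz₁
  haveI := hφ z₂ hz₂
  have h1 := hφw z₁ hz₁
  have h2 := hφw z₂ hz₂
  rw [← h1, ← h2]
  refine eq_of_sameChart_of_not_isRegularLocalRing K Φ Ψ hΦ hΦ0 hΨ G hG hjac hρ (a z₁ hz₁) (a z₂ hz₂) heq
    (φ z₁ hz₁) (φ z₂ hz₂) (hφρ z₁ hz₁) (hφρ z₂ hz₂) (w₀ z₁ hz₁) (w₀ z₂ hz₂) ?_ ?_ ?_ ?_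
  · rw [h1]; exact hz₁.1
  · rw [h2]; exact hz₂.1
  · rw [h1]; exact hz₁.2
  · rw [h2]; exact hz₂.2

end OneStep

end Summit.ResolutionOfSingularities.ResolutionOfSingularities.Cruxes.EquisingularLiftNat.Sections

end
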